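import Literature.Analysis.UnboundedOperators.SemilinearMildGluing
import Literature.Analysis.UnboundedOperators.SemilinearMildTube
import HarnessLib

/-!
# A smooth mild flow on an open neighbourhood of a compact set of data

Analysis/UnboundedOperators support file (everything proved; no definitions, no named facts), companion of
`SemilinearMildTube.lean` and `SemilinearMildGluing.lean`.  Setting: a real Banach space `E`, `T(t)`
(`t ≥ 0`) a strongly continuous contraction semigroup, `K(t)` (`t > 0`) bounded operators, strongly
continuous on `(0, ∞)`, weakly singular (`‖K(t)‖ ≤ C t^{−α}`, `α < 1`) and intertwined
(`K(s + t) = T(s) K(t)`), `N` bounded bilinear, `f ∈ E`; mild solutions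
`y(t) = T(t) y₀ + ∫₀ᵗ T(t − s) f ds − ∫₀ᵗ K(t − s) N(y(s), y(s)) ds`, packaged as curves
`z ∈ C([0, t]; E)` with the integrand clamped by `projIcc` (the form of `exists_mildTube`,
`mild_unique`, and of the Summit-side predicate `ModelFrame.IsMild` of the smooth-model assembly of the
Navier–Stokes semiflow, `Summits/AnomalousDissipation/…ErgodicModelTube.lean`).  This file proves:

* `exists_mild_of_eqOn` — a curve `Y : ℝ → E`, continuous on `[0, L]` and solving the mild identity for
  `r ∈ [0, L]`, packages to a mild solution `z ∈ C([0, t]; E)` with `z = Y` on `[0, t]`, for every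
  `0 ≤ t ≤ L` (the form in which reference trajectories are produced, e.g. by a Duhamel formula);
* `exists_open_mildFlow_of_isCompact` — **the smooth mild flow near a compact set of data** (Henry 1981,
  Thm. 3.4.4 with the continuation theorem Thm. 3.3.4): if every point `y` of a compact `Λ ⊆ E` is the
  datum of a continuous mild solution on `[0, L]` bounded by `B`, then there are an open `U ⊇ Λ` inside
  the ball `‖·‖ < B + 2` and a map `G : E → C([0, L]; E)`, continuous on `U`, with `y ↦ G y t` of class
  `C^∞` on `U` for every `t`, such that for `y ∈ U` the curve `G y` is the mild solution on `[0, L]` from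
  `y` and `‖G y t‖ < B + 1`.  Proof: the tubes of `exists_mildTube` (`ε = 1`) around the given solutions
  cover `Λ`; finitely many suffice (`IsCompact.elim_nhds_subcover`); on overlaps the tube solution maps
  agree by uniqueness (`mild_unique`), so the map selected ballwise is locally one of them, whence its
  continuity and smoothness.

## References

* D. Henry, *Geometric Theory of Semilinear Parabolic Equations*, LNM 840, Springer (1981), Thm. 3.3.3,
  Thm. 3.3.4, Thm. 3.4.1, Thm. 3.4.4. [Henry1981]
* A. Pazy, *Semigroups of Linear Operators and Applications to Partial Differential Equations*, Springer
  (1983), §6.3, Thm. 6.3.1. [Pazy1983]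
-/

noncomputable section

open Set Filter MeasureTheory intervalIntegral Metric
open _root_.Topology
open scoped ContDiff

namespace Literature.Analysis.UnboundedOperators

variable {E : Type*} [NormedAddCommGroup E] [NormedSpace ℝ E]

/-! ### From a curve solving the mild identity to a packaged mild solution -/

/-- **A continuous curve solving the mild identity on `[0, L]` packages to a mild solution on `[0, t]`**
for every `0 ≤ t ≤ L` (the integrands agree on `[0, r]`, where the clamping is the identity). [folklore] -/
theorem exists_mild_of_eqOn (T K : ℝ → E →L[ℝ] E) (N : E →L[ℝ] E →L[ℝ] E) (f : E) {L : ℝ}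
    {Y : ℝ → E} {y : E} (hYc : ContinuousOn Y (Icc 0 L))
    (hY : ∀ r ∈ Icc (0 : ℝ) L, Y r = T r y + (∫ s in (0 : ℝ)..r, T (r - s) f) -
      ∫ s in (0 : ℝ)..r, K (r - s) (N (Y s) (Y s)))
    {t : ℝ} (ht : 0 ≤ t) (htL : t ≤ L) :
    ∃ z : C(Icc (0 : ℝ) t, E),
      (∀ r : Icc (0 : ℝ) t, z r = T r y + (∫ s in (0 : ℝ)..(r : ℝ), T ((r : ℝ) - s) f) -
        ∫ s in (0 : ℝ)..(r : ℝ), K ((r : ℝ) - s) (N (z (projIcc 0 t ht s)) (z (projIcc 0 t ht s)))) ∧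
      ∀ r : Icc (0 : ℝ) t, z r = Y r := by
  have hc : Continuous fun r : Icc (0 : ℝ) t => Y r :=
    continuousOn_iff_continuous_restrict.1 (hYc.mono (Icc_subset_Icc_right htL))
  refine ⟨⟨fun r => Y r, hc⟩, fun r => ?_, fun r => rfl⟩
  show Y r = _
  rw [hY r ⟨r.2.1, r.2.2.trans htL⟩]
  congr 1
  refine intervalIntegral.integral_congr fun s hs => ?_
  rw [uIcc_of_le r.2.1] at hs
  have hs' : s ∈ Icc 0 t := ⟨hs.1, hs.2.trans r.2.2⟩
  show K (r - s) (N (Y s) (Y s)) = K (r - s) (N (Y (projIcc 0 t ht s)) (Y (projIcc 0 t ht s)))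
  rw [projIcc_of_mem ht hs']

/-! ### The smooth mild flow on an open neighbourhood of a compact set of data -/

/-- **Smooth mild flow near a compact set of data** (Henry 1981, Thm. 3.4.4 with the continuation Thm. 3.3.4).
Let `T` be a strongly continuous contraction semigroup, `K` weakly singular (`‖K t‖ ≤ C t^{−α}`, `α < 1`),
strongly continuous on `(0, ∞)` and intertwined (`K (s + t) = T s ∘ K t`), `N` bounded bilinear, `f ∈ E`,
`L > 0`, and `Λ ⊆ E` compact such that every `y ∈ Λ` is the datum of a continuous mild solution on `[0, L]`
bounded by `B`.  Then there are an open `U` with `Λ ⊆ U ⊆ {‖·‖ < B + 2}` and `G : E → C([0, L]; E)`,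
continuous on `U`, with `y ↦ G y t` of class `C^∞` on `U` for every `t`, such that for `y ∈ U`: `G y` is the
mild solution on `[0, L]` from `y` and `‖G y t‖ < B + 1`.  (Finitely many tubes of `exists_mildTube` with
`ε = 1` cover `Λ`; on overlaps the tube solution maps agree by uniqueness.) [cite: Henry1981, Thm 3.3.4 and Thm 3.4.4] -/
theorem exists_open_mildFlow_of_isCompact [CompleteSpace E] (T K : ℝ → E →L[ℝ] E) (hT0 : T 0 = 1)
    (hTadd : ∀ s t, 0 ≤ s → 0 ≤ t → T (s + t) = (T s).comp (T t))
    (hTnorm : ∀ t, 0 ≤ t → ‖T t‖ ≤ 1) (hTc : ∀ y : E, Continuous fun t : ℝ => T t y)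
    {α C : ℝ} (hα : α < 1) (hC : 0 ≤ C) (hK : ∀ t, 0 < t → ‖K t‖ ≤ C * t ^ (-α))
    (hKadd : ∀ s t, 0 ≤ s → 0 < t → K (s + t) = (T s).comp (K t))
    (hKc : ∀ y : E, ContinuousOn (fun t : ℝ => K t y) (Ioi 0))
    (N : E →L[ℝ] E →L[ℝ] E) (f : E) {L : ℝ} (hL : 0 < L) {Λ : Set E} (hΛ : IsCompact Λ) {B : ℝ}
    (href : ∀ y ∈ Λ, ∃ Y : ℝ → E, ContinuousOn Y (Icc 0 L) ∧ (∀ t ∈ Icc 0 L, ‖Y t‖ ≤ B) ∧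
      ∀ t ∈ Icc 0 L, Y t = T t y + (∫ s in (0 : ℝ)..t, T (t - s) f) -
        ∫ s in (0 : ℝ)..t, K (t - s) (N (Y s) (Y s))) :
    ∃ U : Set E, IsOpen U ∧ Λ ⊆ U ∧ U ⊆ ball 0 (B + 2) ∧ ∃ G : E → C(Icc (0 : ℝ) L, E),
      ContinuousOn G U ∧ (∀ t : Icc (0 : ℝ) L, ContDiffOn ℝ ∞ (fun y => G y t) U) ∧
      ∀ y ∈ U, (∀ t : Icc (0 : ℝ) L, G y t = T t y + (∫ s in (0 : ℝ)..(t : ℝ), T ((t : ℝ) - s) f) -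
          ∫ s in (0 : ℝ)..(t : ℝ), K ((t : ℝ) - s)
            (N (G y (Set.projIcc 0 L hL.le s)) (G y (Set.projIcc 0 L hL.le s)))) ∧
        ∀ t : Icc (0 : ℝ) L, ‖G y t‖ < B + 1 := by
  classical
  -- ### Step 1: a tube of radius `≤ 1` around the given solution from every `y ∈ Λ`
  have htube : ∀ y ∈ Λ, ‖y‖ ≤ B ∧ ∃ δ : ℝ, 0 < δ ∧ δ ≤ 1 ∧ ∃ Ψ : E → C(Icc (0 : ℝ) L, E),
      ContinuousOn Ψ (ball y δ) ∧ (∀ t : Icc (0 : ℝ) L, ContDiffOn ℝ ∞ (fun y₀ => Ψ y₀ t) (ball y δ)) ∧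
      ∀ y₀ ∈ ball y δ, (∀ t : Icc (0 : ℝ) L, Ψ y₀ t = T t y₀ +
          (∫ s in (0 : ℝ)..(t : ℝ), T ((t : ℝ) - s) f) - ∫ s in (0 : ℝ)..(t : ℝ), K ((t : ℝ) - s)
            (N (Ψ y₀ (Set.projIcc 0 L hL.le s)) (Ψ y₀ (Set.projIcc 0 L hL.le s)))) ∧
        ∀ t : Icc (0 : ℝ) L, ‖Ψ y₀ t‖ < B + 1 := by
    intro y hy
    obtain ⟨Y, hYc, hYB, hYm⟩ := href y hy
    obtain ⟨yc, hyc, hycY⟩ := exists_mild_of_eqOn T K N f hYc hYm hL.le le_rfl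
    have hyc0 : yc ⟨0, le_rfl, hL.le⟩ = y := mild_apply_zero T K hT0 N f hL.le hyc
    have hycB : ∀ t : Icc (0 : ℝ) L, ‖yc t‖ ≤ B := fun t => by
      rw [hycY t]
      exact hYB t t.2
    refine ⟨hyc0 ▸ hycB _, ?_⟩
    obtain ⟨δ, hδ, Lip, Ψ, hΨc, hΨd, hΨ⟩ := exists_mildTube T K hT0 hTadd hTnorm hTc hα hC hK hKadd hKc
      N f hL yc (fun t => by rw [hyc0]; exact hyc t) one_pos
    rw [hyc0] at hΨc hΨd hΨ
    refine ⟨min δ 1, lt_min hδ one_pos, min_le_right _ _, Ψ,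
      hΨc.mono (ball_subset_ball (min_le_left _ _)),
      fun t => (hΨd t).mono (ball_subset_ball (min_le_left _ _)), fun y₀ hy₀ => ?_⟩
    have hy₀' : y₀ ∈ ball y δ := ball_subset_ball (min_le_left _ _) hy₀
    refine ⟨(hΨ y₀ hy₀').1, fun t => ?_⟩
    have h1 := ((hΨ y₀ hy₀').2.1 t).2
    linarith [norm_le_insert' (Ψ y₀ t) (yc t), hycB t]
  choose! hyB δ hδ hδ1 Ψ hΨc hΨd hΨ using htube
  -- ### Step 2: finitely many tubes cover `Λ`; ballwise index selection; agreement on overlaps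
  obtain ⟨I, hIΛ, hIcov⟩ :=
    hΛ.elim_nhds_subcover (fun y => ball y (δ y)) fun y hy => ball_mem_nhds y (hδ y hy)
  have hsel : ∀ y' : E, ∃ y : E, (y' ∈ ⋃ y ∈ I, ball y (δ y)) → y ∈ I ∧ y' ∈ ball y (δ y) := by
    intro y'
    by_cases h : y' ∈ ⋃ y ∈ I, ball y (δ y)
    · obtain ⟨y, hyI, hy'⟩ := mem_iUnion₂.1 h
      exact ⟨y, fun _ => ⟨hyI, hy'⟩⟩
    · exact ⟨y', fun h' => absurd h' h⟩
  choose j hj using hsel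
  have hagree : ∀ y ∈ I, ∀ y' ∈ ball y (δ y), Ψ (j y') y' = Ψ y y' := fun y hyI y' hy' => by
    obtain ⟨hjI, hjy'⟩ := hj y' (mem_iUnion₂.2 ⟨y, hyI, hy'⟩)
    exact mild_unique T K hTnorm hα hC hK hKc N f hL.le (hΨ _ (hIΛ _ hjI) y' hjy').1
      (hΨ y (hIΛ y hyI) y' hy').1
  -- ### Step 3: the flow selected ballwise on `U = ⋃_{y ∈ I} ball y (δ y)`
  refine ⟨⋃ y ∈ I, ball y (δ y), isOpen_iUnion fun y => isOpen_iUnion fun _ => isOpen_ball, hIcov,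
    fun y' hy' => ?_, fun y' => Ψ (j y') y', fun y' hy' => ?_, fun t => ?_, fun y' hy' => ?_⟩
  · -- `U ⊆ ball 0 (B + 2)`
    obtain ⟨y, hyI, hy'y⟩ := mem_iUnion₂.1 hy'
    rw [mem_ball_zero_iff]
    have h1 : ‖y' - y‖ < 1 := (mem_ball_iff_norm.1 hy'y).trans_le (hδ1 y (hIΛ y hyI))
    linarith [norm_le_insert' y' y, hyB y (hIΛ y hyI)]
  · -- continuity on `U`: locally the selected map is one tube solution map
    obtain ⟨y, hyI, hy'y⟩ := mem_iUnion₂.1 hy'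
    have hca : ContinuousAt (Ψ y) y' :=
      (hΨc y (hIΛ y hyI)).continuousAt (isOpen_ball.mem_nhds hy'y)
    have hev : Ψ y =ᶠ[𝓝 y'] fun y'' => Ψ (j y'') y'' :=
      Filter.eventuallyEq_of_mem (isOpen_ball.mem_nhds hy'y) fun y'' hy'' => (hagree y hyI y'' hy'').symm
    exact (hca.congr hev).continuousWithinAt
  · -- smoothness in the datum at each time
    refine contDiffOn_of_locally_contDiffOn fun y' hy' => ?_
    obtain ⟨y, hyI, hy'y⟩ := mem_iUnion₂.1 hy'
    exact ⟨ball y (δ y), isOpen_ball, hy'y,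
      ((hΨd y (hIΛ y hyI) t).congr fun y'' hy'' => by
        dsimp only
        rw [hagree y hyI y'' hy'']).mono
        inter_subset_right⟩
  · -- the mild identity and the bound
    obtain ⟨y, hyI, hy'y⟩ := mem_iUnion₂.1 hy'
    dsimp only
    rw [hagree y hyI y' hy'y]
    exact hΨ y (hIΛ y hyI) y' hy'y

end Literature.Analysis.UnboundedOperators

end
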